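import Summits.AnomalousDissipation.AnomalousDissipation.Theorems.SolenoidalFractalHomogenisationRealisedQuasiStaticCellLawGammaPos
import HarnessLib

/-!
# K2R `RealisedQuasiStaticCellLaw`, line `floquet-bloch`, stub `stub_lowSectorDecay` (S1D): lower bound of the in-plane
# slaving weight (finite-`n` isotropy input of the W-near road)

Summits-side helper file (everything proved; no definitions, no named facts; `--supports stmt-AnomalousDissipation-20446`).
With `a = |ℓ|`, `b = |K|`, `C = |ℓ·K|`, the link floor `F = (C − a²)/(a(a+b))` of `abs_inPlane_link_ge` (both neighbours) and
the gaps `d_{±1} − d₀ = 1 ± 2(ℓ·K)/b² ≤ 1 + 2C/b²`: the in-plane slaving weight obeys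
`σ_i = s₋₁²/(d₋₁−d₀) + s₀²/(d₁−d₀) ≥ 2·max(F,0)²/(1 + 2C/b²)` (`inPlane_weight_lower`). As `a/b → 0` this is
`2(ℓ̂·K̂)²(1 − O(a/b))`, the nominal in-plane weight of `slotGain_frame`.
-/

set_option linter.dupNamespace false

noncomputable section

namespace Summit.AnomalousDissipation.AnomalousDissipation.Theorems.SolenoidalFractalHomogenisation.RealisedQuasiStaticCellLaw

open Matrix
open scoped Matrix
open Literature.Analysis Literature.Analysis.FunctionSpaces Literature.Analysis.FunctionSpaces.Torus

/-- `freqNormSq` is the real self dot product of the cast vector. -/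
theorem freqNormSq_eq_dotProduct (v : Fin 3 → ℤ) :
    freqNormSq v = (fun i => ((v i : ℤ) : ℝ)) ⬝ᵥ (fun i => ((v i : ℤ) : ℝ)) := by
  simp [freqNormSq, dotProduct, sq]

/-- **Lower bound of the in-plane slaving weight.** -/
theorem inPlane_weight_lower (ℓ K : Fin 3 → ℤ) (hℓ : ℓ ≠ 0) (hK : K ≠ 0) {ζr : Fin 3 → ℝ} (hζ1 : ζr ⬝ᵥ ζr = 1)
    (hζ0 : ζr ⬝ᵥ (fun i => ((ℓ i : ℤ) : ℝ)) = 0) (hζK : ζr ⬝ᵥ (fun i => ((K i : ℤ) : ℝ)) = 0)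
    {p : ℤ → Fin 3 → ℝ}
    (hp : ∀ J : ℤ, p J = (Real.sqrt ((fun i => (((ℓ + J • K) i : ℤ) : ℝ)) ⬝ᵥ (fun i => (((ℓ + J • K) i : ℤ) : ℝ))))⁻¹ •
        (fun i => (((ℓ + J • K) i : ℤ) : ℝ)) ⨯₃ ζr)
    (hgp : 0 < freqNormSq (ℓ + (1 : ℤ) • K) / freqNormSq K - freqNormSq ℓ / freqNormSq K)
    (hgm : 0 < freqNormSq (ℓ + (-1 : ℤ) • K) / freqNormSq K - freqNormSq ℓ / freqNormSq K) :
    2 * (max ((|(fun i => ((ℓ i : ℤ) : ℝ)) ⬝ᵥ (fun i => ((K i : ℤ) : ℝ))| -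
              (fun i => ((ℓ i : ℤ) : ℝ)) ⬝ᵥ (fun i => ((ℓ i : ℤ) : ℝ))) /
            (Real.sqrt ((fun i => ((ℓ i : ℤ) : ℝ)) ⬝ᵥ (fun i => ((ℓ i : ℤ) : ℝ))) *
              (Real.sqrt ((fun i => ((ℓ i : ℤ) : ℝ)) ⬝ᵥ (fun i => ((ℓ i : ℤ) : ℝ))) +
                Real.sqrt ((fun i => ((K i : ℤ) : ℝ)) ⬝ᵥ (fun i => ((K i : ℤ) : ℝ)))))) 0) ^ 2 /
        (1 + 2 * |(fun i => ((ℓ i : ℤ) : ℝ)) ⬝ᵥ (fun i => ((K i : ℤ) : ℝ))| /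
          ((fun i => ((K i : ℤ) : ℝ)) ⬝ᵥ (fun i => ((K i : ℤ) : ℝ)))) ≤
      (p (-1) ⬝ᵥ p 0) ^ 2 / (freqNormSq (ℓ + (-1 : ℤ) • K) / freqNormSq K - freqNormSq ℓ / freqNormSq K) +
        (p 0 ⬝ᵥ p 1) ^ 2 / (freqNormSq (ℓ + (1 : ℤ) • K) / freqNormSq K - freqNormSq ℓ / freqNormSq K) := by
  set lr : Fin 3 → ℝ := fun i => ((ℓ i : ℤ) : ℝ) with hlr
  set Kr : Fin 3 → ℝ := fun i => ((K i : ℤ) : ℝ) with hKr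
  have hpos : ∀ {v : Fin 3 → ℤ}, v ≠ 0 → 0 < (fun i => ((v i : ℤ) : ℝ)) ⬝ᵥ (fun i => ((v i : ℤ) : ℝ)) := by
    intro v hv
    obtain ⟨i, hi⟩ : ∃ i, v i ≠ 0 := by
      by_contra h
      push Not at h
      exact hv (funext h)
    have hi' : ((v i : ℤ) : ℝ) ≠ 0 := by exact_mod_cast hi
    have e : (fun i => ((v i : ℤ) : ℝ)) ⬝ᵥ (fun i => ((v i : ℤ) : ℝ)) = ∑ l, ((v l : ℤ) : ℝ) ^ 2 := by simp [dotProduct, sq]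
    rw [e]
    exact lt_of_lt_of_le (by positivity) (Finset.single_le_sum (fun l _ => sq_nonneg (((v l : ℤ) : ℝ))) (Finset.mem_univ i))
  have hb : 0 < Kr ⬝ᵥ Kr := hpos hK
  obtain ⟨F, hF⟩ : ∃ F : ℝ, F = (|lr ⬝ᵥ Kr| - lr ⬝ᵥ lr) /
      (Real.sqrt (lr ⬝ᵥ lr) * (Real.sqrt (lr ⬝ᵥ lr) + Real.sqrt (Kr ⬝ᵥ Kr))) := ⟨_, rfl⟩
  rw [← hF]
  -- the two links dominate `F`
  have h0 : F ≤ |p 0 ⬝ᵥ p 1| := by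
    rw [hF, hp 0, hp 1]; exact abs_inPlane_link_ge ℓ K hℓ hK hζ1 hζ0 hζK
  have hm : F ≤ |p (-1) ⬝ᵥ p 0| := by
    have hK' : -K ≠ 0 := neg_ne_zero.2 hK
    have hζK' : ζr ⬝ᵥ (fun i => (((-K) i : ℤ) : ℝ)) = 0 := by
      have e : (fun i => (((-K) i : ℤ) : ℝ)) = -Kr := by funext i; simp [hKr]
      rw [e, dotProduct_neg, hζK, neg_zero]
    have h := abs_inPlane_link_ge ℓ (-K) hℓ hK' hζ1 hζ0 hζK'
    have eK : (fun i => (((-K) i : ℤ) : ℝ)) = -Kr := by funext i; simp [hKr]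
    rw [eK, dotProduct_neg, abs_neg, neg_dotProduct, dotProduct_neg, neg_neg] at h
    have e0 : ℓ + (0 : ℤ) • (-K) = ℓ + (0 : ℤ) • K := by simp
    have e1 : ℓ + (1 : ℤ) • (-K) = ℓ + (-1 : ℤ) • K := by simp
    rw [e0, e1, ← hp 0, ← hp (-1), dotProduct_comm (p 0) (p (-1))] at h
    rw [hF]; exact h
  have hsq0 : (max F 0) ^ 2 ≤ (p 0 ⬝ᵥ p 1) ^ 2 := by
    rw [← sq_abs (p 0 ⬝ᵥ p 1)]
    exact pow_le_pow_left₀ (le_max_right _ _) (max_le h0 (abs_nonneg _)) 2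
  have hsqm : (max F 0) ^ 2 ≤ (p (-1) ⬝ᵥ p 0) ^ 2 := by
    rw [← sq_abs (p (-1) ⬝ᵥ p 0)]
    exact pow_le_pow_left₀ (le_max_right _ _) (max_le hm (abs_nonneg _)) 2
  -- the gaps are at most `1 + 2C/b²`
  have hKf : freqNormSq K = Kr ⬝ᵥ Kr := freqNormSq_eq_dotProduct K
  have hℓf : freqNormSq ℓ = lr ⬝ᵥ lr := freqNormSq_eq_dotProduct ℓ
  have hJf : ∀ J : ℤ, freqNormSq (ℓ + J • K) = lr ⬝ᵥ lr + 2 * (J : ℝ) * (lr ⬝ᵥ Kr) + (J : ℝ) ^ 2 * (Kr ⬝ᵥ Kr) := by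
    intro J
    rw [freqNormSq_eq_dotProduct]
    have e : (fun i => (((ℓ + J • K) i : ℤ) : ℝ)) = lr + (J : ℝ) • Kr := by funext i; simp [hlr, hKr]
    rw [e, add_dotProduct, dotProduct_add, dotProduct_add, smul_dotProduct, dotProduct_smul, dotProduct_smul,
      smul_dotProduct, dotProduct_comm Kr lr]
    simp only [smul_eq_mul]
    ring
  have hgap1 : freqNormSq (ℓ + (1 : ℤ) • K) / freqNormSq K - freqNormSq ℓ / freqNormSq K ≤
      1 + 2 * |lr ⬝ᵥ Kr| / (Kr ⬝ᵥ Kr) := by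
    rw [hJf, hℓf, hKf, ← sub_div, div_le_iff₀ hb]
    push_cast
    have := le_abs_self (lr ⬝ᵥ Kr)
    have e : (1 + 2 * |lr ⬝ᵥ Kr| / (Kr ⬝ᵥ Kr)) * (Kr ⬝ᵥ Kr) = Kr ⬝ᵥ Kr + 2 * |lr ⬝ᵥ Kr| := by field_simp
    rw [e]; nlinarith
  have hgapm : freqNormSq (ℓ + (-1 : ℤ) • K) / freqNormSq K - freqNormSq ℓ / freqNormSq K ≤
      1 + 2 * |lr ⬝ᵥ Kr| / (Kr ⬝ᵥ Kr) := by
    rw [hJf, hℓf, hKf, ← sub_div, div_le_iff₀ hb]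
    push_cast
    have := neg_abs_le (lr ⬝ᵥ Kr)
    have e : (1 + 2 * |lr ⬝ᵥ Kr| / (Kr ⬝ᵥ Kr)) * (Kr ⬝ᵥ Kr) = Kr ⬝ᵥ Kr + 2 * |lr ⬝ᵥ Kr| := by field_simp
    rw [e]; nlinarith
  have hD : 0 < 1 + 2 * |lr ⬝ᵥ Kr| / (Kr ⬝ᵥ Kr) := by positivity
  -- assemble: M²/D ≤ s²/gap for both, then add
  have hM0 : 0 ≤ (max F 0) ^ 2 := sq_nonneg _
  have t1 : (max F 0) ^ 2 / (1 + 2 * |lr ⬝ᵥ Kr| / (Kr ⬝ᵥ Kr)) ≤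
      (p 0 ⬝ᵥ p 1) ^ 2 / (freqNormSq (ℓ + (1 : ℤ) • K) / freqNormSq K - freqNormSq ℓ / freqNormSq K) :=
    div_le_div₀ (sq_nonneg _) hsq0 hgp hgap1
  have t2 : (max F 0) ^ 2 / (1 + 2 * |lr ⬝ᵥ Kr| / (Kr ⬝ᵥ Kr)) ≤
      (p (-1) ⬝ᵥ p 0) ^ 2 / (freqNormSq (ℓ + (-1 : ℤ) • K) / freqNormSq K - freqNormSq ℓ / freqNormSq K) :=
    div_le_div₀ (sq_nonneg _) hsqm hgm hgapm
  have e2 : 2 * (max F 0) ^ 2 / (1 + 2 * |lr ⬝ᵥ Kr| / (Kr ⬝ᵥ Kr)) =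
      (max F 0) ^ 2 / (1 + 2 * |lr ⬝ᵥ Kr| / (Kr ⬝ᵥ Kr)) + (max F 0) ^ 2 / (1 + 2 * |lr ⬝ᵥ Kr| / (Kr ⬝ᵥ Kr)) := by ring
  rw [e2]
  linarith [t1, t2]

/-- **The out-of-plane slaving weight is at least `2`** (exactly `2/(1 − y²)`, `y = 2ℓ·K/|K|²`). -/
theorem outPlane_weight_ge_two (ℓ K : Fin 3 → ℤ) (hK : K ≠ 0)
    (hgp : 0 < freqNormSq (ℓ + (1 : ℤ) • K) / freqNormSq K - freqNormSq ℓ / freqNormSq K)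
    (hgm : 0 < freqNormSq (ℓ + (-1 : ℤ) • K) / freqNormSq K - freqNormSq ℓ / freqNormSq K) :
    2 ≤ 1 / (freqNormSq (ℓ + (-1 : ℤ) • K) / freqNormSq K - freqNormSq ℓ / freqNormSq K) +
      1 / (freqNormSq (ℓ + (1 : ℤ) • K) / freqNormSq K - freqNormSq ℓ / freqNormSq K) := by
  set lr : Fin 3 → ℝ := fun i => ((ℓ i : ℤ) : ℝ) with hlr
  set Kr : Fin 3 → ℝ := fun i => ((K i : ℤ) : ℝ) with hKr
  have hb : 0 < Kr ⬝ᵥ Kr := by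
    obtain ⟨i, hi⟩ : ∃ i, K i ≠ 0 := by
      by_contra h
      push Not at h
      exact hK (funext h)
    have hi' : ((K i : ℤ) : ℝ) ≠ 0 := by exact_mod_cast hi
    have e : Kr ⬝ᵥ Kr = ∑ l, ((K l : ℤ) : ℝ) ^ 2 := by simp [hKr, dotProduct, sq]
    rw [e]
    exact lt_of_lt_of_le (by positivity) (Finset.single_le_sum (fun l _ => sq_nonneg (((K l : ℤ) : ℝ))) (Finset.mem_univ i))
  have hKf : freqNormSq K = Kr ⬝ᵥ Kr := freqNormSq_eq_dotProduct K
  have hℓf : freqNormSq ℓ = lr ⬝ᵥ lr := freqNormSq_eq_dotProduct ℓ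
  have hJf : ∀ J : ℤ, freqNormSq (ℓ + J • K) = lr ⬝ᵥ lr + 2 * (J : ℝ) * (lr ⬝ᵥ Kr) + (J : ℝ) ^ 2 * (Kr ⬝ᵥ Kr) := by
    intro J
    rw [freqNormSq_eq_dotProduct]
    have e : (fun i => (((ℓ + J • K) i : ℤ) : ℝ)) = lr + (J : ℝ) • Kr := by funext i; simp [hlr, hKr]
    rw [e, add_dotProduct, dotProduct_add, dotProduct_add, smul_dotProduct, dotProduct_smul, dotProduct_smul,
      smul_dotProduct, dotProduct_comm Kr lr]
    simp only [smul_eq_mul]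
    ring
  obtain ⟨y, hy⟩ : ∃ y : ℝ, y = 2 * (lr ⬝ᵥ Kr) / (Kr ⬝ᵥ Kr) := ⟨_, rfl⟩
  have e1 : freqNormSq (ℓ + (1 : ℤ) • K) / freqNormSq K - freqNormSq ℓ / freqNormSq K = 1 + y := by
    rw [hJf, hℓf, hKf, hy]; field_simp; push_cast; ring
  have em : freqNormSq (ℓ + (-1 : ℤ) • K) / freqNormSq K - freqNormSq ℓ / freqNormSq K = 1 - y := by
    rw [hJf, hℓf, hKf, hy]; field_simp; push_cast; ring
  rw [e1] at hgp ⊢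
  rw [em] at hgm ⊢
  rw [div_add_div _ _ hgm.ne' hgp.ne', le_div_iff₀ (mul_pos hgm hgp)]
  nlinarith [sq_nonneg y]

end Summit.AnomalousDissipation.AnomalousDissipation.Theorems.SolenoidalFractalHomogenisation.RealisedQuasiStaticCellLaw

end
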